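import Summits.QuantumFields.YangMills.Theorems.SwapTwistDeficitAntipodalPersistence
import Summits.QuantumFields.YangMills.Theorems.SwapTwistDeficitSmallBallFloors
import Summits.QuantumFields.YangMills.Theorems.SwapTwistDeficitCauchySchwarzDoor
import HarnessLib

/-!
# WEAK DOOR: the Laplace-window twist deficit (`SwapTwistDeficit.TwistDeficitLaplaceWindow`, stmt-QuantumFields-23776) follows from an
# `O(1)`-probability thermal small-ball estimate for ONE Polyakov pair — no slow bit, no `β^{−a}`-small probability required

Companion of `…SwapTwistDeficitSmallBallDoor` (door through the one-step slow bit: hypothesis SB(a,γ) with probability `≤ β^{−a}/8`).  For the crux W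
of LINE g11-A (seat ym-idea-4) alone, the ANTIPODAL correlation `insTrace L β O L` suffices (landed `CauchySchwarzDoor`, p671260), and it needs only
`insTrace(O, L) ≥ β^{−k} Z_phys(2L)`: the swap-odd sign bit `O = sign(polDist − polDist∘S)` must not be COMPLETELY randomised after `L` transfer steps.
With the antipodal persistence bound (`TT.insTrace_ge_of_persistence_sum`, p682320) this reduces W to

  (SBW)(a, γ):  ∃ β₀ L₀, ∀ β ≥ β₀, ∀ L₀ ≤ L ≤ β^a:  `insTrace L β 𝟙{|polDist − polDist∘S| ≤ β^{−γ}} 0 ≤ (1/2 − β^{−a}) · Z_phys(2L)`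

— the thermal probability that the `x`- and `y`-holonomy distances-to-centre are `β^{−γ}`-close is at most `1/2 − β^{−a}` (an `O(1)` margin, not a small
probability).  ★ `twistDeficitLaplaceWindow_of_weakSmallBall`: for `0 < a ≤ 1`, `γ < 1/2 − 4a`, (SBW)(a,γ) ⇒ `TwistDeficitLaplaceWindow` (with this `a`,
`k = 2a + 1`).  Heuristically (fixed-`L` toron collapse: the toron modulus is log-uniform on `[β^{−1/4}, 1]`, memo on item 23776) the strip at width `β^{−γ}`
has thermal mass `→ 1 − 4γ` for `γ < 1/4` and `→ 0` for `γ > 1/4`, so (SBW) is expected for every `γ > 1/8`, e.g. `(a, γ) = (1/20, 1/4)`.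
Unconditional ingredients: §1 the width of the `L`-step persistence strip `2L²·t ≤ β^{−γ}` on `L ≤ β^a` (`βt²/2 = (a + 2LN + 4)·log β`); §2 the door
(far bonds cost `≤ (β^{−a}/2)·Z` against the explicit floor `Z ≥ (e^{2β|E|}β^{−N})^{2L}`; then `insTrace(O,L) ≥ β^{−a} Z` and Cauchy–Schwarz).

(SBW) is NOT proved here and is not a published fact: it is the residual crux.  HONEST FRAMING: a reduction between fixed-lattice statements; no summit /
rung statement is proved; the YM mass gap is NOT proved.  No `sorry`, no new axiom, no new definition.
References: [cite: tHooft1979Flux]; [cite: MadrasSokal1988, §2]; [cite: ReedSimonIV1978, Thm. XIII.1]; [cite: Luscher1983, §2]; [cite: SeilerLNP1982, §3].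
-/

set_option autoImplicit false

noncomputable section

open MeasureTheory Filter Topology Real Function
open scoped Matrix ComplexConjugate BigOperators
open Literature.MathematicalPhysics.QuantumLattice
open Literature.MathematicalPhysics.QuantumFieldTheory hiding SU2
open Summit.QuantumFields.YangMills.Theorems

namespace Summit.QuantumFields.YangMills.Theorems.FemtoTransferGap.TT

open Summit.QuantumFields.YangMills.Theorems.FemtoTransferGap

/-! ## §1 The width of the `L`-step persistence strip -/

/-- **The `L`-step persistence strip is polynomially thin on the window.**  For `a ≤ 1` and `γ < 1/2 − 4a` there is `β₁` such that for all `β ≥ β₁` and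
`1 ≤ L ≤ β^a`: `2L·(L·√(2(a + 2L·N + 4)·log β / β)) ≤ β^{−γ}`, `N = 8|P| + 97|E|` (width `O(L⁴√(log β/β)) = O(β^{4a − 1/2 + o(1)})`). [folklore] -/
theorem stripWidth_antipodal_le_rpow {a γ : ℝ} (ha1 : a ≤ 1) (hγ : γ < 1 / 2 - 4 * a) :
    ∃ β₁ : ℝ, 9 ≤ β₁ ∧ ∀ β : ℝ, β₁ ≤ β → ∀ (L : ℕ) [NeZero L], (L : ℝ) ≤ β ^ a →
      2 * (L : ℝ) * ((L : ℝ) * Real.sqrt (2 * (a + 2 * L * (8 * Fintype.card (Plaquette 3 L) + 97 * Fintype.card (Edge 3 L) : ℝ) + 4) * Real.log β / β)) ≤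
        β ^ (-γ) := by
  set δ : ℝ := 1 - 8 * a - 2 * γ with hδ
  have hδ0 : 0 < δ := by rw [hδ]; linarith
  refine ⟨max 9 ((2 * 5848 / δ) ^ (2 / δ)), le_max_left _ _, fun β hβ L _ hLβ => ?_⟩
  have hβ9 : 9 ≤ β := (le_max_left _ _).trans hβ
  have hβ0 : 0 < β := by linarith
  have hβ1 : 1 ≤ β := by linarith
  have hL1 : (1 : ℝ) ≤ L := by exact_mod_cast NeZero.one_le
  have hL0 : (0 : ℝ) < L := by linarith
  have hlog0 : 0 ≤ Real.log β := Real.log_nonneg hβ1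
  have hL8 : (L : ℝ) ^ 8 ≤ β ^ (8 * a) := by
    have h := pow_le_pow_left₀ hL0.le hLβ 8
    rwa [← Real.rpow_natCast (β ^ a) 8, ← Real.rpow_mul hβ0.le, show a * ((8 : ℕ) : ℝ) = 8 * a by push_cast; ring] at h
  have hN := exponent_le (L := L)
  -- the square of the width is `≤ 5848 L⁸ log β / β ≤ 5848 β^{8a} log β / β`
  have hrad : (2 * (L : ℝ) * L) ^ 2 * (2 * (a + 2 * L * (8 * Fintype.card (Plaquette 3 L) + 97 * Fintype.card (Edge 3 L) : ℝ) + 4) * Real.log β / β) ≤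
      5848 * β ^ (8 * a) * Real.log β / β := by
    rw [mul_div_assoc, mul_div_assoc, ← mul_assoc]
    refine mul_le_mul_of_nonneg_right ?_ (div_nonneg hlog0 hβ0.le)
    have hL3 : (1 : ℝ) ≤ (L : ℝ) ^ 3 := one_le_pow₀ hL1
    calc (2 * (L : ℝ) * L) ^ 2 * (2 * (a + 2 * L * (8 * Fintype.card (Plaquette 3 L) + 97 * Fintype.card (Edge 3 L) : ℝ) + 4))
        ≤ (2 * (L : ℝ) * L) ^ 2 * (2 * (1 + 2 * L * (363 * (L : ℝ) ^ 3) + 4)) := by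
          refine mul_le_mul_of_nonneg_left (mul_le_mul_of_nonneg_left ?_ (by norm_num)) (by positivity)
          nlinarith [mul_le_mul_of_nonneg_left hN (by positivity : (0 : ℝ) ≤ 2 * L)]
      _ = 40 * (L : ℝ) ^ 4 + 5808 * (L : ℝ) ^ 8 := by ring
      _ ≤ 5848 * (L : ℝ) ^ 8 := by
          have hL48 : (L : ℝ) ^ 4 ≤ (L : ℝ) ^ 8 := pow_le_pow_right₀ hL1 (by norm_num)
          linarith
      _ ≤ 5848 * β ^ (8 * a) := by nlinarith [hL8]
  have hlog : Real.log β ≤ β ^ (δ / 2) / (δ / 2) := Real.log_le_rpow_div hβ0.le (by positivity)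
  have hthr : 2 * 5848 / δ ≤ β ^ (δ / 2) := by
    have h := (le_max_right 9 ((2 * 5848 / δ) ^ (2 / δ))).trans hβ
    have h' := Real.rpow_le_rpow (by positivity) h (by positivity : (0 : ℝ) ≤ δ / 2)
    rwa [← Real.rpow_mul (by positivity), show 2 / δ * (δ / 2) = 1 by field_simp, Real.rpow_one] at h'
  have hsq : (2 * (L : ℝ) * L) ^ 2 * (2 * (a + 2 * L * (8 * Fintype.card (Plaquette 3 L) + 97 * Fintype.card (Edge 3 L) : ℝ) + 4) * Real.log β / β) ≤
      β ^ (-(2 * γ)) := by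
    refine hrad.trans ?_
    have e1 : β ^ (-(2 * γ)) = β ^ (8 * a) * β ^ δ / β := by
      rw [← Real.rpow_add hβ0, div_eq_mul_inv, ← Real.rpow_neg_one, ← Real.rpow_add hβ0]; congr 1; rw [hδ]; ring
    rw [e1]
    refine div_le_div_of_nonneg_right ?_ hβ0.le
    have hβδ : 0 < β ^ (δ / 2) := Real.rpow_pos_of_pos hβ0 _
    have hδsq : β ^ δ = β ^ (δ / 2) * β ^ (δ / 2) := by rw [← Real.rpow_add hβ0]; congr 1; ring
    rw [hδsq]
    calc 5848 * β ^ (8 * a) * Real.log β ≤ 5848 * β ^ (8 * a) * (β ^ (δ / 2) / (δ / 2)) :=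
          mul_le_mul_of_nonneg_left hlog (by positivity)
      _ = β ^ (8 * a) * (β ^ (δ / 2) * (2 * 5848 / δ)) := by field_simp
      _ ≤ β ^ (8 * a) * (β ^ (δ / 2) * β ^ (δ / 2)) :=
          mul_le_mul_of_nonneg_left (mul_le_mul_of_nonneg_left hthr hβδ.le) (by positivity)
  have hlhs : 2 * (L : ℝ) * ((L : ℝ) * Real.sqrt (2 * (a + 2 * L * (8 * Fintype.card (Plaquette 3 L) + 97 * Fintype.card (Edge 3 L) : ℝ) + 4) * Real.log β / β)) =
      Real.sqrt ((2 * (L : ℝ) * L) ^ 2 * (2 * (a + 2 * L * (8 * Fintype.card (Plaquette 3 L) + 97 * Fintype.card (Edge 3 L) : ℝ) + 4) * Real.log β / β)) := by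
    rw [Real.sqrt_mul (by positivity), Real.sqrt_sq (by positivity)]; ring
  rw [hlhs]
  have hrhs : β ^ (-γ) = Real.sqrt (β ^ (-(2 * γ))) := by
    rw [show -(2 * γ) = -γ * 2 by ring, Real.rpow_mul hβ0.le, Real.rpow_two, Real.sqrt_sq (Real.rpow_nonneg hβ0.le _)]
  rw [hrhs]
  exact Real.sqrt_le_sqrt hsq

end Summit.QuantumFields.YangMills.Theorems.FemtoTransferGap.TT

namespace Summit.QuantumFields.YangMills.Theorems.SwapTwistDeficit

open Summit.QuantumFields.YangMills.Theorems.FemtoTransferGap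
open Summit.QuantumFields.YangMills.Theorems.FemtoTransferGap.FlatSheet

/-! ## §2 The weak door -/

set_option maxHeartbeats 800000 in
/-- ★ **WEAK DOOR — the Laplace-window twist deficit from an `O(1)`-probability small-ball estimate.**  Let `0 < a ≤ 1`, `γ < 1/2 − 4a`, and SUPPOSE
(SBW): there are `β₀, L₀` with `insTrace L β 𝟙{|polDist − polDist∘S| ≤ β^{−γ}} 0 ≤ (1/2 − β^{−a})·Z_phys(2L)` for all `β ≥ β₀`, `L₀ ≤ L ≤ β^a`.  THEN
`TwistDeficitLaplaceWindow` holds with this `a` and `k = 2a + 1`: for `β ≥ β₀'`, `L₀' ≤ L ≤ β^a`, `β^{−(2a+1)} Z_phys(2L) ≤ Z_phys(2L) − Z^S_phys(2L)`.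
Proof: the sign witness `O` satisfies `insTrace(O, L) ≥ Z − 2·insTrace(𝟙_strip, 0) − 2(2L−1)·(far-bond cost)` with the strip of width `2L²t`,
`βt²/2 = (a + 2LN + 4) log β` (`TT.insTrace_ge_of_persistence_sum`); the far bonds cost `≤ (β^{−a}/2)·Z` against the floor `Z ≥ (e^{2β|E|}β^{−N})^{2L}`;
`2L²t ≤ β^{−γ}` on the window; so (SBW) gives `insTrace(O,L) ≥ β^{−a} Z`, and `CauchySchwarzDoor` gives `Z − Z^S ≥ β^{−2a}Z/2`.
[cite: tHooft1979Flux] [cite: MadrasSokal1988, §2] [cite: ReedSimonIV1978, Thm. XIII.1] -/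
theorem twistDeficitLaplaceWindow_of_weakSmallBall {a γ : ℝ} (ha : 0 < a) (ha1 : a ≤ 1) (hγ : γ < 1 / 2 - 4 * a)
    (hSB : ∃ β₀ : ℝ, ∃ L₀ : ℕ, ∀ β : ℝ, β₀ ≤ β → ∀ (L : ℕ) [NeZero L], L₀ ≤ L → (L : ℝ) ≤ β ^ a →
      TT.insTrace L β (Set.indicator {U : GaugeConfig 3 L FemtoTransferGap.SU2 |
          |polDist U - polDist (configPerm (Equiv.swap (0 : Fin 3) 1) U)| ≤ β ^ (-γ)} fun _ => (1 : ℝ)) 0 ≤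
        (1 / 2 - β ^ (-a)) * TT.physTrace L β (2 * L)) :
    Summit.QuantumFields.YangMills.Theses.SwapTwistDeficit.TwistDeficitLaplaceWindow := by
  obtain ⟨β₀, L₀, hSB⟩ := hSB
  obtain ⟨β₁, hβ₁9, hwidth⟩ := TT.stripWidth_antipodal_le_rpow ha1 hγ
  set w₀ : ℝ := Real.exp (-(1 / 2 : ℝ)) * (8 / (3 * π ^ 3)) with hw₀
  refine ⟨a, ha, 2 * a + 1, max (max β₀ β₁) (4 / w₀), max L₀ 2, fun β hβ L _ hL hLβ => ?_⟩
  have hββ₀ : β₀ ≤ β := ((le_max_left _ _).trans (le_max_left _ _)).trans hβ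
  have hββ₁ : β₁ ≤ β := ((le_max_right _ _).trans (le_max_left _ _)).trans hβ
  have hβw : 4 / w₀ ≤ β := (le_max_right _ _).trans hβ
  have hβ9 : 9 ≤ β := hβ₁9.trans hββ₁
  have hβ1 : 1 ≤ β := by linarith
  have hβ0 : 0 < β := by linarith
  have hβ2 : 2 ≤ β := by linarith
  have hL2 : 2 ≤ L := (le_max_right _ _).trans hL
  have hL1 : 1 ≤ L := by omega
  have hL₀ : L₀ ≤ L := (le_max_left _ _).trans hL
  have hLr : (1 : ℝ) ≤ L := by exact_mod_cast hL1
  have hLβ' : (L : ℝ) ≤ β := by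
    refine hLβ.trans ?_
    calc β ^ a ≤ β ^ (1 : ℝ) := Real.rpow_le_rpow_of_exponent_le hβ1 ha1
      _ = β := Real.rpow_one β
  -- data
  set S := configPerm (G := FemtoTransferGap.SU2) (L := L) (Equiv.swap (0 : Fin 3) 1) with hS
  set E : ℕ := Fintype.card (Edge 3 L) with hE
  set P : ℕ := Fintype.card (Plaquette 3 L) with hP
  set N : ℕ := 8 * P + 97 * E with hN
  set M : ℝ := Real.exp (2 * β) ^ E with hM
  set Z : ℝ := TT.physTrace L β (2 * L) with hZ
  set ZS : ℝ := TT.twistTrace L β (2 * L) with hZS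
  set c : ℝ := a + 2 * L * (8 * (P : ℝ) + 97 * (E : ℝ)) + 4 with hc
  set t : ℝ := Real.sqrt (2 * c * Real.log β / β) with ht
  have hM0 : 0 < M := by positivity
  have hZpos : 0 < Z := TT.physTrace_two_mul_pos hL1 hβ1
  have hlog0 : 0 ≤ Real.log β := Real.log_nonneg hβ1
  have hc0 : 0 ≤ c := by rw [hc]; positivity
  have ht0 : 0 ≤ t := Real.sqrt_nonneg _
  -- the witness
  set O : GaugeConfig 3 L FemtoTransferGap.SU2 → ℝ := fun U => Real.sign (polDist U - polDist (S U)) with hO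
  have hOP : IsPhys O := isPhys_signWitness
  have hOb : ∀ U, |O U| ≤ 1 := abs_signWitness_le_one
  have hodd : ∀ U, O (S U) = -O U := signWitness_swap
  -- the antipodal persistence bound along the chain
  set A : Set (GaugeConfig 3 L FemtoTransferGap.SU2) := {U | |polDist U - polDist (S U)| ≤ 2 * L * (L * t)} with hA
  have hAm : MeasurableSet A := measurableSet_strip _
  have hslot : (⟨L % (2 * L - 1 + 1), Nat.mod_lt _ (Nat.succ_pos _)⟩ : Fin (2 * L - 1 + 1)) = ⟨L, by omega⟩ :=
    Fin.ext (Nat.mod_eq_of_lt (by omega))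
  have hpt : ∀ Us : Fin (2 * L - 1 + 1) → GaugeConfig 3 L FemtoTransferGap.SU2,
      1 - 2 * A.indicator (fun _ => (1 : ℝ)) (Us 0) -
          2 * ∑ i : Fin (2 * L - 1), Set.indicator {p : GaugeConfig 3 L FemtoTransferGap.SU2 × GaugeConfig 3 L FemtoTransferGap.SU2 |
              ∃ e, t < frobNorm ((p.1 e : Matrix (Fin 2) (Fin 2) ℂ) - (p.2 e : Matrix (Fin 2) (Fin 2) ℂ))} (fun _ => (1 : ℝ)) (Us i.castSucc, Us i.succ) ≤
        O (Us 0) * O (Us ⟨L % (2 * L - 1 + 1), Nat.mod_lt _ (Nat.succ_pos _)⟩) := by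
    intro Us
    rw [hslot]
    have h := one_sub_le_signWitness_mul_antipodal Us t (m := L) (n := 2 * L - 1) (by omega)
    simpa only [hA, hS, hO] using h
  have hpers := TT.insTrace_ge_of_persistence_sum hβ0.le hOP.measurable hOb hAm ht0 hpt
  -- (i) the strip term, by (SBW) and monotonicity
  have hwid : 2 * (L : ℝ) * ((L : ℝ) * t) ≤ β ^ (-γ) := by
    have h := hwidth β hββ₁ L hLβ
    simpa only [ht, hc] using h
  have hAB : A ⊆ {U | |polDist U - polDist (S U)| ≤ β ^ (-γ)} := fun U hU => le_trans hU hwid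
  have hstrip : TT.insTrace L β (A.indicator fun _ => (1 : ℝ)) 0 ≤ (1 / 2 - β ^ (-a)) * Z :=
    (TT.insTrace_indicator_zero_mono hβ0.le hAm (measurableSet_strip _) hAB).trans (hSB β hββ₀ L hL₀ hLβ)
  -- (ii) the floor `Z ≥ (M β^{-N})^{2L}`
  have hlam : M * (β ^ N)⁻¹ ≤ levelValue su2Rep L β 0 := TT.levelValue_zero_ge_rpow hβ9 hβw
  have hfloor : (M * (β ^ N)⁻¹) ^ (2 * L) ≤ Z :=
    (pow_le_pow_left₀ (by positivity) hlam _).trans (TT.pow_levelValue_zero_le_physTrace hL1 hβ1)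
  -- (iii) the far term: `(2L−1)·η M^{2L-2} M ≤ (β^{-a}/4)·Z`
  have hβt : β * t ^ 2 / 2 = c * Real.log β := by
    have h2 : t ^ 2 = 2 * c * Real.log β / β := by rw [ht, Real.sq_sqrt (by positivity)]
    rw [h2]
    field_simp
  have eExp : Real.exp (-(β * t ^ 2 / 2)) = β ^ (-c) := by
    rw [hβt, Real.rpow_def_of_pos hβ0]; congr 1; ring
  have eM : Real.exp (β * (2 * (E : ℝ) - t ^ 2 / 2)) = M * Real.exp (-(β * t ^ 2 / 2)) := by
    rw [hM, ← Real.exp_nat_mul, ← Real.exp_add]; congr 1; ring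
  have hη : Real.exp (β * (2 * (E : ℝ) - t ^ 2 / 2)) * M ^ (2 * L - 2) * M = β ^ (-c) * M ^ (2 * L) := by
    rw [eM, eExp]
    have e2 : M ^ (2 * L) = M * M ^ (2 * L - 2) * M := by
      have h : M ^ (2 * L) = M ^ (2 * L - 2) * M ^ 2 := by rw [← pow_add]; congr 1; omega
      rw [h]; ring
    rw [e2]; ring
  have hNc : β ^ (-c) = β ^ (-a) * ((β ^ N) ^ (2 * L))⁻¹ * β ^ (-(4 : ℝ)) := by
    rw [hc, show -(a + 2 * L * (8 * (P : ℝ) + 97 * (E : ℝ)) + 4) = -a + -(((2 * L * N : ℕ) : ℝ)) + -(4 : ℝ) by rw [hN]; push_cast; ring,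
      Real.rpow_add hβ0, Real.rpow_add hβ0, Real.rpow_neg hβ0.le (((2 * L * N : ℕ) : ℝ)), Real.rpow_natCast, mul_comm (2 * L) N, pow_mul]
  have hβ4 : 2 * (2 * L - 1 : ℕ) * β ^ (-(4 : ℝ)) ≤ 1 / 4 := by
    rw [Real.rpow_neg hβ0.le, show (4 : ℝ) = ((4 : ℕ) : ℝ) by norm_num, Real.rpow_natCast]
    have hcast : ((2 * L - 1 : ℕ) : ℝ) ≤ 2 * (L : ℝ) := by
      have : 2 * L - 1 ≤ 2 * L := Nat.sub_le _ _
      exact_mod_cast this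
    have h1 : 2 * ((2 * L - 1 : ℕ) : ℝ) ≤ 4 * β := by nlinarith [hcast, hLβ']
    have h2 : (16 : ℝ) * β ≤ β ^ 4 := by
      have h729 : (729 : ℝ) ≤ β ^ 3 := by
        calc (729 : ℝ) = 9 ^ 3 := by norm_num
          _ ≤ β ^ 3 := pow_le_pow_left₀ (by norm_num) hβ9 3
      nlinarith
    rw [mul_inv_le_iff₀ (by positivity)]
    linarith
  have hfar : 2 * (2 * L - 1 : ℕ) * (Real.exp (β * (2 * (E : ℝ) - t ^ 2 / 2)) * M ^ (2 * L - 2) * M) ≤ β ^ (-a) / 4 * Z := by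
    rw [hη, hNc]
    have hkey : ((β ^ N) ^ (2 * L))⁻¹ * M ^ (2 * L) ≤ Z := by
      rw [← inv_pow, ← mul_pow, mul_comm]; exact hfloor
    have hpos1 : 0 ≤ β ^ (-a) := Real.rpow_nonneg hβ0.le _
    calc 2 * (2 * L - 1 : ℕ) * (β ^ (-a) * ((β ^ N) ^ (2 * L))⁻¹ * β ^ (-(4 : ℝ)) * M ^ (2 * L))
        = β ^ (-a) * (2 * (2 * L - 1 : ℕ) * β ^ (-(4 : ℝ))) * (((β ^ N) ^ (2 * L))⁻¹ * M ^ (2 * L)) := by ring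
      _ ≤ β ^ (-a) * (1 / 4) * Z := mul_le_mul (mul_le_mul_of_nonneg_left hβ4 hpos1) hkey (by positivity) (by positivity)
      _ = β ^ (-a) / 4 * Z := by ring
  -- (iv) combine: `insTrace(O, L) ≥ β^{-a} Z`
  have hIL : β ^ (-a) * Z ≤ TT.insTrace L β O L := by
    have h := hpers
    rw [← hZ] at h
    nlinarith [h, hstrip, hfar, Real.rpow_nonneg hβ0.le (-a), hZpos]
  -- (v) Cauchy–Schwarz door
  have hC : TT.insTrace L β O L ^ 2 ≤ 2 * Z * (Z - ZS) := cauchySchwarzDoor_proof L hL2 β hβ1 O hOP hOb hodd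
  have hIL0 : 0 ≤ β ^ (-a) * Z := mul_nonneg (Real.rpow_nonneg hβ0.le _) hZpos.le
  have hsq : (β ^ (-a) * Z) ^ 2 ≤ 2 * Z * (Z - ZS) := (pow_le_pow_left₀ hIL0 hIL 2).trans hC
  have hdef : β ^ (-a) * β ^ (-a) * Z ≤ 2 * (Z - ZS) := by
    have h : (β ^ (-a) * β ^ (-a) * Z) * Z ≤ (2 * (Z - ZS)) * Z := by nlinarith [hsq]
    exact le_of_mul_le_mul_right h hZpos
  have e1 : β ^ (-(2 * a + 1)) = β ^ (-a) * β ^ (-a) * β⁻¹ := by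
    rw [show -(2 * a + 1) = -a + -a + (-1 : ℝ) by ring, Real.rpow_add hβ0, Real.rpow_add hβ0, Real.rpow_neg_one]
  rw [e1]
  have hβinv : β⁻¹ ≤ 1 / 2 := by rw [inv_eq_one_div]; exact div_le_div_of_nonneg_left zero_le_one (by norm_num) hβ2
  have hkk : 0 ≤ β ^ (-a) * β ^ (-a) := mul_nonneg (Real.rpow_nonneg hβ0.le _) (Real.rpow_nonneg hβ0.le _)
  calc β ^ (-a) * β ^ (-a) * β⁻¹ * Z ≤ β ^ (-a) * β ^ (-a) * (1 / 2) * Z :=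
        mul_le_mul_of_nonneg_right (mul_le_mul_of_nonneg_left hβinv hkk) hZpos.le
    _ = (β ^ (-a) * β ^ (-a) * Z) / 2 := by ring
    _ ≤ Z - ZS := by linarith

end Summit.QuantumFields.YangMills.Theorems.SwapTwistDeficit

end
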